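import Summits.QuantumAdvantage.QuantumAdvantage.Theorems.SosSandwichQuerySecondLevelWeight
import HarnessLib

/-!
# `Q_T`: DEGREE-FREE influence bound for the Walsh level `2T − 1` of a `T`-query acceptance probability

Support theorem for route `SosSandwich`, crux `PseudoBoundedAA` (stmt-QuantumAdvantage-15237); Part 3 of the second
level (`SosSandwichQuerySecondLevelStep`, `SosSandwichQuerySecondLevelWeight`).

* `norm_pairing_second_le_two` — `|Σ_{|U|=2T−1} c_U B(U)| ≤ 2` for weights with `Σ_{U∋k}|c_U|² ≤ 1` (`T ≥ 2`);
* `sum_dotProduct_symmDiff_eq_second`, `cubeFourierCoeff_acceptProb_second` — for `|U| = 2T−1`,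
  `p̂(U) = 2 Re B(U)` with `B(U) = topCoeff A U`;
* **`secondLevelWeight_sq_le_influence`** — for EVERY `T`-query algorithm with `T ≥ 2` and every polynomial `p`
  agreeing with its acceptance probability on the cube: `∃ i, (Σ_{|U| = 2T−1} p̂(U)²)² ≤ 4·Inf_i[p]`;
* **`twoTopLevels_rung`** — if the non-constant Walsh mass of `p` sits on levels `2T−1` and `2T` only, then
  `∃ i, Var[p]² ≤ 16·Inf_i[p]` (degree-free two-level rung on `Q_T`).

Together with `topWeight_sq_le_influence` (`4 (Σ_{|U|=2T} p̂(U)²)² ≤ Inf_i`): the two highest Walsh levels of a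
genuine quantum acceptance probability both obey degree-free Aaronson–Ambainis-type bounds; the refuted-on-`K_T`
degree-free rung thus extends, on `Q_T`, one level below the top.  Levels `≤ 2T−2` (repeated indices) are not covered.
All proved, standard axioms.

Sources: EscuderoGutierrez2023 (arXiv:2304.06713) Thm 1.6, §4.2, Remark 4.3; BealsEtAl2001 Lemma 4.1; ODonnell2014 §1.4, §2.2.
-/

noncomputable section

set_option linter.dupNamespace false

namespace Summit.QuantumAdvantage.QuantumAdvantage.Theorems.SosSandwich.QueryTopLevel

open Matrix Finset Literature.Computability.Cryptography Literature.Computability.QuantumComplexity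
open Literature.Computability.Complexity.LowDegree Literature.Probability.RandomGraphs.LowDegree
open Summit.QuantumAdvantage.QuantumAdvantage.Theorems.SosSandwich.QueryFourier
open scoped symmDiff

variable {N : ℕ} {W : Type*} [Fintype W]

/-! ### The pairing bound and the Walsh coefficients at level `2T − 1` -/

/-- **Pairing bound one below the top**: `|Σ_{|U| = 2T−1} c_U B(U)| ≤ 2` for weights with `Σ_{U ∋ k} |c_U|² ≤ 1`
(`T ≥ 2`). [cite: EscuderoGutierrez2023, §4.2] -/
theorem norm_pairing_second_le_two (A : QQueryAlg N) (hT : 2 ≤ A.queries) (c : Finset (Fin N) → ℂ)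
    (hc : ∀ k : Fin N,
      ∑ U ∈ Finset.univ.filter (fun U : Finset (Fin N) => U.card = 2 * A.queries - 1 ∧ k ∈ U), ‖c U‖ ^ 2 ≤ 1) :
    ‖∑ U ∈ Finset.univ.filter (fun U : Finset (Fin N) => U.card = 2 * A.queries - 1), c U * topCoeff A U‖ ≤ 2 := by
  rw [← pairing_eq']
  set F := Finset.univ.filter (fun R : Finset (Fin N) => R.card = A.queries)
  set a : Finset (Fin N) → ℝ := fun R => ∑ s, ‖accVfc A R s‖ ^ 2
  set b : Finset (Fin N) → ℝ := fun R => ∑ s, ‖gam c (2 * A.queries - 1) (fun x => A.finalState x) R s‖ ^ 2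
  have ha : ∀ R, 0 ≤ a R := fun R => Finset.sum_nonneg fun s _ => by positivity
  have hb : ∀ R, 0 ≤ b R := fun R => Finset.sum_nonneg fun s _ => by positivity
  have hA : ∑ R ∈ F, a R ≤ 1 := sum_norm_sq_accVfc_le A
  have hB : ∑ R ∈ F, b R ≤ 4 := sum_norm_sq_gam_second_finalState_le A hT c hc
  calc ‖∑ R ∈ F, star (accVfc A R) ⬝ᵥ gam c (2 * A.queries - 1) (fun x => A.finalState x) R‖
      ≤ ∑ R ∈ F, ‖star (accVfc A R) ⬝ᵥ gam c (2 * A.queries - 1) (fun x => A.finalState x) R‖ :=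
        norm_sum_le _ _
    _ ≤ ∑ R ∈ F, Real.sqrt (a R) * Real.sqrt (b R) :=
        Finset.sum_le_sum fun R _ => norm_star_dotProduct_le _ _
    _ ≤ Real.sqrt (∑ R ∈ F, a R) * Real.sqrt (∑ R ∈ F, b R) := Real.sum_sqrt_mul_sqrt_le F ha hb
    _ ≤ Real.sqrt 1 * Real.sqrt 4 := by gcongr
    _ = 2 := by
        rw [Real.sqrt_one, one_mul, show (4 : ℝ) = 2 ^ 2 by norm_num, Real.sqrt_sq (by norm_num)]

/-- For a state of level `≤ T` and `|U| = 2T − 1` (`T ≥ 1`), the pairs contributing to `Σ_S ⟨v_S, v_{S∆U}⟩` are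
`(R, U∖R)` and `(U∖R, R)` with `R ⊆ U`, `|R| = T`. [cite: BealsEtAl2001, Lemma 4.1] -/
theorem sum_dotProduct_symmDiff_eq_second {T : ℕ} (hT : 1 ≤ T) {v : Finset (Fin N) → Fin N × Bool × W → ℂ}
    (hv : ∀ S : Finset (Fin N), T < S.card → v S = 0) {U : Finset (Fin N)} (hU : U.card = 2 * T - 1) :
    ∑ S : Finset (Fin N), star (v S) ⬝ᵥ v (S ∆ U) =
      ∑ R ∈ Finset.univ.filter (fun R : Finset (Fin N) => R.card = T ∧ R ⊆ U),
        (star (v R) ⬝ᵥ v (U \ R) + star (v (U \ R)) ⬝ᵥ v R) := by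
  set F := Finset.univ.filter (fun R : Finset (Fin N) => R.card = T ∧ R ⊆ U) with hF
  set G := Finset.univ.filter (fun S : Finset (Fin N) => S.card = T - 1 ∧ S ⊆ U) with hG
  have hsd : ∀ S : Finset (Fin N), S ⊆ U → S ∆ U = U \ S := by
    intro S hS
    ext j
    simp only [Finset.mem_symmDiff, Finset.mem_sdiff]
    constructor
    · rintro (⟨hjS, hjU⟩ | ⟨hjU, hjS⟩)
      · exact absurd (hS hjS) hjU
      · exact ⟨hjU, hjS⟩
    · rintro ⟨hjU, hjS⟩; exact Or.inr ⟨hjU, hjS⟩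
  -- restrict the sum to `F ∪ G`
  have hdisj : Disjoint F G := by
    rw [Finset.disjoint_left]
    intro S hSF hSG
    rw [hF, Finset.mem_filter] at hSF
    rw [hG, Finset.mem_filter] at hSG
    omega
  rw [← Finset.sum_subset (Finset.subset_univ (F ∪ G)), Finset.sum_union hdisj, Finset.sum_add_distrib]
  · congr 1
    · refine Finset.sum_congr rfl fun R hR => ?_
      rw [hF, Finset.mem_filter] at hR
      rw [hsd R hR.2.2]
    · -- re-index `G` by `R ↦ U \ R` from `F`
      symm
      refine Finset.sum_nbij' (fun R => U \ R) (fun S => U \ S) ?_ ?_ ?_ ?_ ?_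
      · intro R hR
        rw [hF, Finset.mem_filter] at hR
        rw [hG, Finset.mem_filter]
        refine ⟨Finset.mem_univ _, ?_, Finset.sdiff_subset⟩
        rw [Finset.card_sdiff_of_subset hR.2.2, hU, hR.2.1]; omega
      · intro S hS
        rw [hG, Finset.mem_filter] at hS
        rw [hF, Finset.mem_filter]
        refine ⟨Finset.mem_univ _, ?_, Finset.sdiff_subset⟩
        rw [Finset.card_sdiff_of_subset hS.2.2, hU, hS.2.1]; omega
      · intro R hR
        rw [hF, Finset.mem_filter] at hR
        exact Finset.sdiff_sdiff_eq_self hR.2.2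
      · intro S hS
        rw [hG, Finset.mem_filter] at hS
        exact Finset.sdiff_sdiff_eq_self hS.2.2
      · intro R hR
        rw [hF, Finset.mem_filter] at hR
        rw [hsd (U \ R) Finset.sdiff_subset, Finset.sdiff_sdiff_eq_self hR.2.2]
  · -- all other terms vanish
    intro S _ hS
    simp only [Finset.mem_union, not_or, hF, hG, Finset.mem_filter, Finset.mem_univ, true_and] at hS
    have hSF : ¬(S.card = T ∧ S ⊆ U) := hS.1
    have hSG : ¬(S.card = T - 1 ∧ S ⊆ U) := hS.2
    by_cases h1 : T < S.card
    · rw [hv S h1, star_zero, zero_dotProduct]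
    · have h2 : T < (S ∆ U).card := by
        by_contra h2
        push Not at h1 h2
        have hsub : U \ S ⊆ S ∆ U := fun j hj => by
          rw [Finset.mem_sdiff] at hj
          exact Finset.mem_symmDiff.mpr (Or.inr ⟨hj.1, hj.2⟩)
        have hsub' : S \ U ⊆ S ∆ U := fun j hj => by
          rw [Finset.mem_sdiff] at hj
          exact Finset.mem_symmDiff.mpr (Or.inl ⟨hj.1, hj.2⟩)
        have hdu : Disjoint (U \ S) (S \ U) := by
          rw [Finset.disjoint_left]
          intro j hj hj'
          rw [Finset.mem_sdiff] at hj hj'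
          exact hj'.2 hj.1
        have h3 : (U \ S).card + (S \ U).card ≤ T := by
          rw [← Finset.card_union_of_disjoint hdu]
          exact (Finset.card_le_card (Finset.union_subset hsub hsub')).trans h2
        have h4 : (U \ S).card + (U ∩ S).card = U.card := Finset.card_sdiff_add_card_inter U S
        have h5 : (S \ U).card + (S ∩ U).card = S.card := Finset.card_sdiff_add_card_inter S U
        have h6 : (U ∩ S).card = (S ∩ U).card := by rw [Finset.inter_comm]
        have h7 : (S ∩ U).card ≤ S.card := Finset.card_le_card Finset.inter_subset_left
        -- so `S \ U = ∅` and `|S| ∈ {T-1, T}`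
        have h8 : (S \ U).card = 0 := by omega
        have hSU : S ⊆ U := by
          intro j hj
          by_contra hjU
          have : j ∈ S \ U := Finset.mem_sdiff.mpr ⟨hj, hjU⟩
          rw [Finset.card_eq_zero.mp h8] at this
          exact absurd this (Finset.notMem_empty j)
        rcases Nat.lt_or_ge (S.card) T with hlt | hge
        · exact hSG ⟨by omega, hSU⟩
        · exact hSF ⟨by omega, hSU⟩
      rw [hv _ h2, dotProduct_zero]

/-- `⟨b, a⟩ = conj ⟨a, b⟩` for the complex dot product. [folklore] -/
theorem star_dotProduct_comm' {ι : Type*} [Fintype ι] (a b : ι → ℂ) :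
    star b ⬝ᵥ a = star (star a ⬝ᵥ b) := by
  simp only [dotProduct, Pi.star_apply, star_sum, star_mul, star_star, mul_comm]

/-- **The Walsh coefficient of the acceptance probability one below the top**: for `|U| = 2T − 1` (`T ≥ 1`),
`p̂(U) = 2 Re B(U)` with `B(U) = topCoeff A U`. [cite: EscuderoGutierrez2023, §4.2] -/
theorem cubeFourierCoeff_acceptProb_second (A : QQueryAlg N) (hT : 1 ≤ A.queries) {U : Finset (Fin N)}
    (hU : U.card = 2 * A.queries - 1) :
    cubeFourierCoeff (fun x => A.acceptProb x) U = 2 * (topCoeff A U).re := by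
  classical
  set φ : (Fin N → Bool) → Fin N × Bool × A.W → ℂ := fun x s => if s ∈ A.accept then A.finalState x s else 0
    with hφ
  have hvφ : ∀ S, vfc φ S = accVfc A S := by
    intro S
    funext s
    simp only [vfc, accVfc, hφ]
    split_ifs with hs
    · rfl
    · simp
  have hlev : ∀ S : Finset (Fin N), A.queries < S.card → vfc φ S = 0 := by
    intro S hS
    rw [hvφ]
    funext s
    simp only [accVfc, Pi.zero_apply]
    rw [level_finalState A S hS]
    simp
  have hp : ∀ x, A.acceptProb x = ∑ s, ‖φ x s‖ ^ 2 := by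
    intro x
    unfold QQueryAlg.acceptProb
    rw [Finset.sum_filter]
    refine Finset.sum_congr rfl fun s _ => ?_
    simp only [hφ]
    split_ifs <;> simp
  unfold cubeFourierCoeff
  simp_rw [hp]
  rw [fourierCoeff_norm_sq φ U, sum_dotProduct_symmDiff_eq_second hT hlev hU]
  simp_rw [hvφ]
  rw [Finset.sum_add_distrib, Complex.add_re]
  have h2 : (∑ R ∈ Finset.univ.filter (fun R : Finset (Fin N) => R.card = A.queries ∧ R ⊆ U),
      star (accVfc A (U \ R)) ⬝ᵥ accVfc A R) = star (topCoeff A U) := by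
    rw [topCoeff, star_sum]
    exact Finset.sum_congr rfl fun R _ => star_dotProduct_comm' _ _
  rw [h2, Complex.star_def, Complex.conj_re]
  change (topCoeff A U).re + (topCoeff A U).re = _
  ring

/-- **Second-highest level versus influence** — for every `T`-query algorithm with `T ≥ 2` and every polynomial
`p` agreeing with its acceptance probability on the cube, some variable has
`(W^{=2T−1}[p])² ≤ 4·Inf_i[p]`, where `W^{=2T−1}[p] = Σ_{|U| = 2T−1} p̂(U)²` — a DEGREE-FREE influence bound for
the Walsh level one below the top (for the top level: `4 (W^{=2T})² ≤ Inf_i`, file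
`SosSandwichQueryHomogeneousRung`). [cite: EscuderoGutierrez2023, Thm 1.6 / Remark 4.3] -/
theorem secondLevelWeight_sq_le_influence (A : QQueryAlg N) (hT : 2 ≤ A.queries) (p : MvPolynomial (Fin N) ℝ)
    (hp : ∀ x, evalBool p x = A.acceptProb x) :
    ∃ i : Fin N, (∑ U ∈ Finset.univ.filter (fun U : Finset (Fin N) => U.card = 2 * A.queries - 1),
        cubeFourierCoeff (evalBool p) U ^ 2) ^ 2 ≤ 4 * influence i p := by
  have hfun : evalBool p = fun x => A.acceptProb x := funext hp
  have hN : (Finset.univ : Finset (Fin N)).Nonempty := ⟨A.start.1, Finset.mem_univ _⟩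
  set T₂ := 2 * A.queries - 1 with hT₂
  set ph : Finset (Fin N) → ℝ := fun U => cubeFourierCoeff (evalBool p) U with hph
  set m : Fin N → ℝ := fun k =>
    ∑ U ∈ Finset.univ.filter (fun U : Finset (Fin N) => U.card = T₂ ∧ k ∈ U), ph U ^ 2
  obtain ⟨k₀, -, hk₀⟩ := Finset.exists_max_image Finset.univ m hN
  refine ⟨k₀, ?_⟩
  set M := m k₀
  set V := ∑ U ∈ Finset.univ.filter (fun U : Finset (Fin N) => U.card = T₂), ph U ^ 2 with hVdef
  have hm0 : ∀ k, 0 ≤ m k := fun k => Finset.sum_nonneg fun U _ => by positivity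
  have hM0 : 0 ≤ M := hm0 k₀
  have hV0 : 0 ≤ V := Finset.sum_nonneg fun U _ => by positivity
  -- `4 m k₀ ≤ Inf_{k₀}`
  have hInf : 4 * M ≤ influence k₀ p := by
    rw [influence_eq_sum_sq_fourier]
    refine mul_le_mul_of_nonneg_left ?_ (by norm_num)
    exact Finset.sum_le_sum_of_subset_of_nonneg
      (fun U hU => by
        rw [Finset.mem_filter] at hU ⊢
        exact ⟨hU.1, hU.2.2⟩)
      fun U _ _ => sq_nonneg _
  suffices hVM : V ^ 2 ≤ 16 * M by linarith
  by_cases hM : M = 0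
  · have hzero : ∀ U ∈ Finset.univ.filter (fun U : Finset (Fin N) => U.card = T₂), ph U ^ 2 = 0 := by
      intro U hU
      rw [Finset.mem_filter] at hU
      have hne : U.Nonempty := by rw [← Finset.card_pos, hU.2]; omega
      obtain ⟨k, hk⟩ := hne
      have hmk : m k = 0 := le_antisymm ((hk₀ k (Finset.mem_univ k)).trans hM.le) (hm0 k)
      have hle : ph U ^ 2 ≤ m k :=
        Finset.single_le_sum (f := fun U => ph U ^ 2) (fun U _ => by positivity)
          (Finset.mem_filter.mpr ⟨Finset.mem_univ U, hU.2, hk⟩)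
      exact le_antisymm (hle.trans hmk.le) (by positivity)
    have hV : V = 0 := Finset.sum_eq_zero hzero
    rw [hV, hM]; norm_num
  · have hMpos : 0 < M := lt_of_le_of_ne hM0 (Ne.symm hM)
    have hsq : 0 < Real.sqrt M := Real.sqrt_pos.mpr hMpos
    -- real weights `c_U = p̂(U)/√M`
    set c : Finset (Fin N) → ℂ := fun U => ((ph U / Real.sqrt M : ℝ) : ℂ)
    have hcnorm : ∀ U, ‖c U‖ ^ 2 = ph U ^ 2 / M := by
      intro U
      simp only [c]
      rw [Complex.norm_real, Real.norm_eq_abs, sq_abs, div_pow, Real.sq_sqrt hM0]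
    have hc : ∀ k : Fin N,
        ∑ U ∈ Finset.univ.filter (fun U : Finset (Fin N) => U.card = 2 * A.queries - 1 ∧ k ∈ U), ‖c U‖ ^ 2 ≤ 1 := by
      intro k
      simp_rw [hcnorm]
      rw [← Finset.sum_div, div_le_one hMpos]
      exact hk₀ k (Finset.mem_univ k)
    have hpair := norm_pairing_second_le_two A hT c hc
    -- `2 Re Z = V / √M`
    have hre : (∑ U ∈ Finset.univ.filter (fun U : Finset (Fin N) => U.card = 2 * A.queries - 1),
        c U * topCoeff A U).re * 2 = V / Real.sqrt M := by
      rw [Complex.re_sum, Finset.sum_mul, hVdef, Finset.sum_div]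
      refine Finset.sum_congr rfl fun U hU => ?_
      rw [Finset.mem_filter] at hU
      simp only [c, Complex.re_ofReal_mul]
      have hb := cubeFourierCoeff_acceptProb_second A (by omega) hU.2
      rw [← hfun] at hb
      simp only [hph]
      rw [hb]
      ring
    have hre_le : (∑ U ∈ Finset.univ.filter (fun U : Finset (Fin N) => U.card = 2 * A.queries - 1),
        c U * topCoeff A U).re * 2 ≤ 4 :=
      by nlinarith [Complex.re_le_norm (∑ U ∈ Finset.univ.filter (fun U : Finset (Fin N) =>
        U.card = 2 * A.queries - 1), c U * topCoeff A U)]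
    rw [hre, div_le_iff₀ hsq] at hre_le
    calc V ^ 2 ≤ (4 * Real.sqrt M) ^ 2 := pow_le_pow_left₀ hV0 hre_le 2
      _ = 16 * M := by rw [mul_pow, Real.sq_sqrt hM0]; norm_num


/-- **The two-top-levels rung on `Q_T`.**  If the acceptance polynomial `p` of a `T`-query algorithm (`T ≥ 2`) has
its non-constant Walsh mass on the two highest levels `2T − 1` and `2T` only, then some variable has
`Var[p]² ≤ 16·Inf_i[p]` — degree-free (combine `topWeight_sq_le_influence` and
`secondLevelWeight_sq_le_influence` on the heavier of the two levels). [cite: EscuderoGutierrez2023, Cor 1.7] -/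
theorem twoTopLevels_rung (A : QQueryAlg N) (hT : 2 ≤ A.queries) (p : MvPolynomial (Fin N) ℝ)
    (hp : ∀ x, evalBool p x = A.acceptProb x)
    (hspec : ∀ S : Finset (Fin N), S ≠ ∅ → S.card ≠ 2 * A.queries → S.card ≠ 2 * A.queries - 1 →
      cubeFourierCoeff (evalBool p) S = 0) :
    ∃ i : Fin N, boolVariance p ^ 2 ≤ 16 * influence i p := by
  set F₁ := Finset.univ.filter (fun S : Finset (Fin N) => S.card = 2 * A.queries)
  set F₂ := Finset.univ.filter (fun S : Finset (Fin N) => S.card = 2 * A.queries - 1)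
  set W₁ := ∑ S ∈ F₁, cubeFourierCoeff (evalBool p) S ^ 2
  set W₂ := ∑ S ∈ F₂, cubeFourierCoeff (evalBool p) S ^ 2
  have hW₁ : 0 ≤ W₁ := Finset.sum_nonneg fun S _ => sq_nonneg _
  have hW₂ : 0 ≤ W₂ := Finset.sum_nonneg fun S _ => sq_nonneg _
  -- `Var = W₁ + W₂`
  have hdisj : Disjoint F₁ F₂ := by
    rw [Finset.disjoint_left]
    intro S h1 h2
    simp only [F₁, F₂, Finset.mem_filter, Finset.mem_univ, true_and] at h1 h2
    omega
  have hvar : boolVariance p = W₁ + W₂ := by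
    rw [boolVariance_eq_sum_sq_fourier, ← Finset.sum_union hdisj,
      ← Finset.sum_subset (Finset.subset_univ (F₁ ∪ F₂))]
    · refine Finset.sum_congr rfl fun S hS => ?_
      have hS0 : S ≠ ∅ := by
        intro h
        simp only [Finset.mem_union, F₁, F₂, Finset.mem_filter, Finset.mem_univ, true_and] at hS
        rw [h, Finset.card_empty] at hS
        omega
      rw [if_neg hS0]
    · intro S _ hS
      simp only [Finset.mem_union, F₁, F₂, Finset.mem_filter, Finset.mem_univ, true_and, not_or] at hS
      by_cases hS0 : S = ∅
      · rw [if_pos hS0]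
      · rw [if_neg hS0, hspec S hS0 hS.1 hS.2]; ring
  obtain ⟨i₁, h₁⟩ := topWeight_sq_le_influence A (by omega) p hp
  obtain ⟨i₂, h₂⟩ := secondLevelWeight_sq_le_influence A hT p hp
  change 4 * W₁ ^ 2 ≤ influence i₁ p at h₁
  change W₂ ^ 2 ≤ 4 * influence i₂ p at h₂
  have hI₁ := influence_nonneg i₁ p
  have hI₂ := influence_nonneg i₂ p
  rcases le_total W₂ W₁ with hle | hle
  · refine ⟨i₁, ?_⟩
    rw [hvar]
    nlinarith
  · refine ⟨i₂, ?_⟩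
    rw [hvar]
    nlinarith


/-- **Robust two-top-levels rung on `Q_T`.**  If a fraction `η > 0` of the variance of the acceptance polynomial `p`
of a `T`-query algorithm (`T ≥ 2`) sits on the two highest Walsh levels, `η·Var[p] ≤ W^{=2T}[p] + W^{=2T−1}[p]`,
then `∃ i, η²·Var[p]² ≤ 16·Inf_i[p]`. [cite: EscuderoGutierrez2023, Cor 1.7] -/
theorem twoTopLevels_rung_robust (A : QQueryAlg N) (hT : 2 ≤ A.queries) (p : MvPolynomial (Fin N) ℝ)
    (hp : ∀ x, evalBool p x = A.acceptProb x) {η : ℝ} (hη : 0 ≤ η)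
    (hmass : η * boolVariance p ≤
      (∑ S ∈ Finset.univ.filter (fun S : Finset (Fin N) => S.card = 2 * A.queries),
          cubeFourierCoeff (evalBool p) S ^ 2) +
        ∑ S ∈ Finset.univ.filter (fun S : Finset (Fin N) => S.card = 2 * A.queries - 1),
          cubeFourierCoeff (evalBool p) S ^ 2) :
    ∃ i : Fin N, η ^ 2 * boolVariance p ^ 2 ≤ 16 * influence i p := by
  set W₁ := ∑ S ∈ Finset.univ.filter (fun S : Finset (Fin N) => S.card = 2 * A.queries),
    cubeFourierCoeff (evalBool p) S ^ 2
  set W₂ := ∑ S ∈ Finset.univ.filter (fun S : Finset (Fin N) => S.card = 2 * A.queries - 1),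
    cubeFourierCoeff (evalBool p) S ^ 2
  have hW₁ : 0 ≤ W₁ := Finset.sum_nonneg fun S _ => sq_nonneg _
  have hW₂ : 0 ≤ W₂ := Finset.sum_nonneg fun S _ => sq_nonneg _
  have hV : 0 ≤ η * boolVariance p := mul_nonneg hη (boolVariance_nonneg p)
  obtain ⟨i₁, h₁⟩ := topWeight_sq_le_influence A (by omega) p hp
  obtain ⟨i₂, h₂⟩ := secondLevelWeight_sq_le_influence A hT p hp
  change 4 * W₁ ^ 2 ≤ influence i₁ p at h₁
  change W₂ ^ 2 ≤ 4 * influence i₂ p at h₂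
  have hI₁ := influence_nonneg i₁ p
  have hI₂ := influence_nonneg i₂ p
  have hsq : η ^ 2 * boolVariance p ^ 2 = (η * boolVariance p) ^ 2 := by ring
  rw [hsq]
  rcases le_total W₂ W₁ with hle | hle
  · refine ⟨i₁, ?_⟩
    have h3 : η * boolVariance p ≤ 2 * W₁ := by linarith
    nlinarith
  · refine ⟨i₂, ?_⟩
    have h3 : η * boolVariance p ≤ 2 * W₂ := by linarith
    nlinarith

end Summit.QuantumAdvantage.QuantumAdvantage.Theorems.SosSandwich.QueryTopLevel

end
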